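import Summits.QuantumFields.YangMills.Theorems.ForcedResponseSkewnessResponseLocalisationDefs
import Mathlib.Geometry.Manifold.PartitionOfUnity
import HarnessLib

/-!
# Crux `ResponseLocalisation` (stmt-QuantumFields-23615), line `birth`: registered stub `stub_shell` (Schwartz plateau function)

Support file (`--supports stmt-QuantumFields-23615`) of the lead prover of route `ForcedResponseSkewness` (unit
`ym-line-frs-p1`).  For a real Schwartz `v` on `ℝ⁴` and radii `0 < δ < D` there is a real Schwartz `f` with values in
`[0, 1]`, equal to `1` on the shell `{δ ≤ infDist(·, K)} ∩ {‖·‖ ≤ D}` and with `tsupport f` disjoint from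
`K = tsupport v ∪ tsupport θv` (hence from both pieces).

Proof: the shell `A` is compact (closed and bounded in `ℝ⁴`) and sits inside the open
`U = {δ/2 < infDist(·, K)} ∩ ball 0 (D+1)`; the smooth Urysohn lemma (Mathlib's
`exists_contMDiffMap_zero_one_of_isClosed` on the model space, for `Uᶜ` and `A`) gives a smooth `g` with `g = 0` off `U`,
`g = 1` on `A`, `0 ≤ g ≤ 1`; its support lies in the bounded `U`, so `g` is compactly supported and smooth, hence Schwartz
(`HasCompactSupport.toSchwartzMap`), and `tsupport g ⊆ closure U ⊆ {δ/2 ≤ infDist(·, K)}` misses `K` (where `infDist = 0`).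

Honest label: a bookkeeping stub of a conditional rung line (leaf R2a `BalabanLadder.NT`); nothing here bears on the
Yang–Mills mass gap, which is NOT proved by this.
-/

set_option autoImplicit false

noncomputable section

namespace Summit.QuantumFields.YangMills.Cruxes.ResponseLocalisation.Birth

open Set Metric Topology
open scoped Manifold ContDiff
open Literature.MathematicalPhysics.QuantumLattice

/-- **Smooth Urysohn plateau with values in `[0,1]`** on a finite-dimensional real space: for a compact `A` inside an
open `U` there is a smooth `g : V → ℝ` with `g = 1` on `A`, `support g ⊆ U`, `0 ≤ g ≤ 1`. [folklore] -/
theorem exists_contDiff_plateau {V : Type*} [NormedAddCommGroup V] [NormedSpace ℝ V] [FiniteDimensional ℝ V]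
    {A U : Set V} (hA : IsCompact A) (hU : IsOpen U) (hAU : A ⊆ U) :
    ∃ g : V → ℝ, ContDiff ℝ ∞ g ∧ EqOn g 1 A ∧ Function.support g ⊆ U ∧ ∀ x, g x ∈ Icc (0 : ℝ) 1 := by
  obtain ⟨g, hg0, hg1, hg01⟩ := exists_contMDiffMap_zero_one_of_isClosed (I := 𝓘(ℝ, V)) (M := V)
    (n := (⊤ : ℕ∞)) hU.isClosed_compl hA.isClosed (disjoint_compl_left_iff_subset.2 hAU)
  refine ⟨g, contMDiff_iff_contDiff.1 g.contMDiff, hg1, fun x hx => ?_, hg01⟩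
  by_contra h
  exact hx (hg0 h)

/-- **Registered stub `stub_shell` of line `birth`** (crux `ResponseLocalisation`, stmt-QuantumFields-23615): the Schwartz
plateau function of the shell `{δ ≤ infDist(·, tsupport v ∪ tsupport θv)} ∩ {‖·‖ ≤ D}`. [folklore] -/
theorem stub_shell : ShellSig := by
  intro v δ D hδ hδD
  set K : Set (EuclideanSpace ℝ (Fin 4)) := tsupport v ∪ tsupport (thetaTest 4 v) with hK
  set A : Set (EuclideanSpace ℝ (Fin 4)) := {y | δ ≤ infDist y K} ∩ closedBall 0 D with hA
  set U : Set (EuclideanSpace ℝ (Fin 4)) := {y | δ / 2 < infDist y K} ∩ ball 0 (D + 1) with hU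
  have hAc : IsClosed A := (isClosed_le continuous_const (continuous_infDist_pt K)).inter isClosed_closedBall
  have hAcpt : IsCompact A := (isCompact_closedBall (0 : EuclideanSpace ℝ (Fin 4)) D).of_isClosed_subset hAc
    inter_subset_right
  have hUo : IsOpen U := (isOpen_lt continuous_const (continuous_infDist_pt K)).inter isOpen_ball
  have hAU : A ⊆ U := by
    intro y hy
    refine ⟨?_, ?_⟩
    · have h1 : δ ≤ infDist y K := hy.1
      show δ / 2 < infDist y K
      linarith
    · have h2 : y ∈ closedBall (0 : EuclideanSpace ℝ (Fin 4)) D := hy.2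
      rw [mem_closedBall] at h2
      rw [mem_ball]
      linarith
  obtain ⟨g, hgd, hg1, hgs, hg01⟩ := exists_contDiff_plateau hAcpt hUo hAU
  have hts : tsupport g ⊆ closure U := closure_mono hgs
  have hcl1 : closure U ⊆ {y | δ / 2 ≤ infDist y K} :=
    closure_minimal (fun y hy => show δ / 2 ≤ infDist y K from le_of_lt hy.1)
      (isClosed_le continuous_const (continuous_infDist_pt K))
  have hcl2 : closure U ⊆ closedBall 0 (D + 1) :=
    closure_minimal (fun y hy => ball_subset_closedBall hy.2) isClosed_closedBall
  have hcpt : HasCompactSupport g :=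
    IsCompact.of_isClosed_subset (isCompact_closedBall _ _) (isClosed_tsupport _) (hts.trans hcl2)
  -- `tsupport g` misses `K` (there `infDist = 0 < δ/2`)
  have hdisjK : Disjoint (tsupport g) K := by
    rw [Set.disjoint_left]
    intro y hyg hyK
    have h1 : δ / 2 ≤ infDist y K := hcl1 (hts hyg)
    have h2 : infDist y K = 0 := infDist_zero_of_mem hyK
    linarith
  refine ⟨hcpt.toSchwartzMap hgd, ?_, ?_, ?_, ?_⟩
  · exact hdisjK.mono_right subset_union_left
  · exact hdisjK.mono_right subset_union_right
  · intro y
    exact hg01 y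
  · intro y hyδ hyD
    have hyA : y ∈ A := ⟨hyδ, mem_closedBall_zero_iff.2 hyD⟩
    exact hg1 hyA

end Summit.QuantumFields.YangMills.Cruxes.ResponseLocalisation.Birth

end
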